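import Mathlib
import Literature.MathematicalPhysics.KineticTheory.FouriersLaw

/-!
# Crux `ExtensiveSnapshotIrreversibility` (stmt-AtomisticToContinuum-9121), fixed-`N` half `K_fix`:
the ENERGY-WINDOW reduction — part 1/4, tree lemmas and the elementary toolkit

(helper file, theorem-side.)  The energy-window reduction `K_fix ⟸ (W) ⟸ (R)` is spread over four
files: this one (tree lemmas re-proved + pointwise inequalities), `…EnergyWindow` (the abstract seam:
a flip-invariant probability measure `μ₀`, a weight `W`, a tilted state `μ₀ · e^{φ}`, split at the
`δ`-adaptive Lyapunov window `e^{(θ/6)W} ≤ 1/|δ|`), `…EnergyWindowStatements` (the texts `K_fix`,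
`(W)` for the pinned chain and `(W) ⟹ K_fix`) and `…EnergyWindowChain` (the regularity atoms of
record `(R)` and `(R) ⟹ (W)`, `(R) ⟹ K_fix`).

§0 (landing revisions, reviewers of p847350 / p847405): the twelve flip/tilt/test-function lemmas of the
seat's namespace `…EnergyWindow.Tree` were verbatim re-proofs of TREE lemmas
(`…ExtensiveSnapshotIrreversibility.Negative.{DegenerateInstances,TiltedCriterion}`,
`…ClausiusBudget.OddLogDensity` = `…OddLogDensityOfRegularity{,Aux1}`) and are deleted; the downstream
`…EnergyWindow*` files import those modules and `open` the two namespaces instead of `Tree`; this file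
keeps only the route-independent inequalities (imports Mathlib + Literature only).  §1. Pointwise inequalities for the bulk/tail split
(`(a − b)(e^a − e^b) ≤ (e^a − e^b)²/L`, `1/(1 − η) ≤ 1 + 2η`, the window algebra).  §2. Two weighted
Cauchy–Schwarz inequalities and the identification `μ₀.withDensity e^{φ} = μ₀.tilted φ` for a
probability measure.  No new objects. [folklore throughout]
References: L. Rey-Bellet, L. E. Thomas, Comm. Math. Phys. 225 (2002) 305 (Lyapunov function
`e^{θH}`, uniform exponential moments of the NESS); P. Carmona, Stoch. Proc. Appl. 117 (2007) 1076
(pinned chains); J.-P. Eckmann, C.-A. Pillet, L. Rey-Bellet, J. Stat. Phys. 95 (1999) 305 (a priori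
bounds on the NESS density); M. Hairer, A. J. Majda, Nonlinearity 23 (2010) 909 (linear response of
hypoelliptic NESS); T. Lelièvre, G. Stoltz, Acta Numerica 25 (2016) 681, §5 (`L²(μ)` linear response
of the invariant density); J. A. McLennan, Phys. Rev. 115 (1959) 1405.
-/

noncomputable section

namespace Summit.AtomisticToContinuum.FouriersLaw.Theorems.ExtensiveSnapshotIrreversibility.EnergyWindow

open MeasureTheory Filter Topology InformationTheory Real
open scoped ENNReal NNReal
open Literature.MathematicalPhysics.KineticTheory.HeatConduction

variable {N : ℕ}

-- §0 («Tree lemmas re-proved verbatim», namespace `EnergyWindow.Tree`) DELETED at landing (reviewer revisions on p847350 / p847405, hand-2 g27):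
-- the twelve lemmas are the tree's originals under `…ExtensiveSnapshotIrreversibility.Negative` (DegenerateInstances / TiltedCriterion) and
-- `…ClausiusBudget.OddLogDensity` (…OddLogDensityOfRegularity{,Aux1}); the DOWNSTREAM files import and open them.  This file is now a
-- route-independent pure-inequality helper (imports: Mathlib + Literature `…KineticTheory.FouriersLaw` for `PhaseSpace`).

/-! ## 1. Elementary pointwise inequalities -/

/-- For `b ≤ a` and `0 < L ≤ e^b`: `(a − b)(e^a − e^b) ≤ (e^a − e^b)²/L`
(`a − b ≤ (e^a − e^b)/e^b` from `1 + u ≤ e^u`). [folklore] -/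
theorem sub_mul_exp_sub_exp_le_sq_div_of_le {a b L : ℝ} (h : b ≤ a) (hL : 0 < L)
    (hLb : L ≤ exp b) : (a - b) * (exp a - exp b) ≤ (exp a - exp b) ^ 2 / L := by
  have hab : exp b ≤ exp a := exp_le_exp.2 h
  have hnum : 0 ≤ exp a - exp b := sub_nonneg.2 hab
  have h1 : (a - b) * exp b ≤ exp a - exp b := by
    have h0 := add_one_le_exp (a - b)
    have he : exp (a - b) * exp b = exp a := by rw [← exp_add]; ring_nf
    nlinarith [mul_le_mul_of_nonneg_right h0 (exp_pos b).le]
  have h2 : a - b ≤ (exp a - exp b) / L := by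
    rw [le_div_iff₀ hL]
    calc (a - b) * L ≤ (a - b) * exp b := mul_le_mul_of_nonneg_left hLb (sub_nonneg.2 h)
      _ ≤ exp a - exp b := h1
  calc (a - b) * (exp a - exp b) ≤ (exp a - exp b) / L * (exp a - exp b) :=
        mul_le_mul_of_nonneg_right h2 hnum
    _ = (exp a - exp b) ^ 2 / L := by ring

/-- **Log-mean lower bound, symmetric form.** If `e^a, e^b ≥ L > 0` then
`(a − b)(e^a − e^b) ≤ (e^a − e^b)²/L` (the logarithmic mean of `e^a, e^b` is at least
`min(e^a, e^b) ≥ L`). [folklore] -/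
theorem sub_mul_exp_sub_exp_le_sq_div {a b L : ℝ} (hL : 0 < L) (hLa : L ≤ exp a)
    (hLb : L ≤ exp b) : (a - b) * (exp a - exp b) ≤ (exp a - exp b) ^ 2 / L := by
  rcases le_total b a with h | h
  · exact sub_mul_exp_sub_exp_le_sq_div_of_le h hL hLb
  · have := sub_mul_exp_sub_exp_le_sq_div_of_le h hL hLa
    calc (a - b) * (exp a - exp b) = (b - a) * (exp b - exp a) := by ring
      _ ≤ (exp b - exp a) ^ 2 / L := this
      _ = (exp a - exp b) ^ 2 / L := by ring

/-- `1/(1 − η) ≤ 1 + 2η` for `0 ≤ η ≤ 1/2`. [folklore] -/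
theorem one_div_one_sub_le {η : ℝ} (h0 : 0 ≤ η) (h1 : η ≤ 1 / 2) : 1 / (1 - η) ≤ 1 + 2 * η := by
  rw [div_le_iff₀ (by linarith)]
  nlinarith

/-- On the complement of the window: if `1/u < e^{κ w}` (`u > 0`) then
`e^{3κ w} ≤ u³ · e^{6κ w}`. [folklore] -/
theorem exp_three_mul_le_of_window {κ w u : ℝ} (hu : 0 < u) (h : 1 / u < exp (κ * w)) :
    exp (3 * κ * w) ≤ u ^ 3 * exp (6 * κ * w) := by
  have h3 : exp (3 * κ * w) = exp (κ * w) ^ 3 := by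
    rw [← exp_nat_mul]; ring_nf
  have h6 : exp (6 * κ * w) = exp (κ * w) ^ 3 * exp (κ * w) ^ 3 := by
    rw [← pow_add, ← exp_nat_mul]; ring_nf
  rw [h3, h6]
  have hy : 0 < exp (κ * w) := exp_pos _
  have h1 : 1 ≤ u * exp (κ * w) := by
    have := (div_lt_iff₀ hu).1 h
    linarith
  have h2 : 1 ≤ (u * exp (κ * w)) ^ 3 := one_le_pow₀ h1
  have hy3 : 0 < exp (κ * w) ^ 3 := pow_pos hy 3
  calc exp (κ * w) ^ 3 = 1 * exp (κ * w) ^ 3 := by ring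
    _ ≤ (u * exp (κ * w)) ^ 3 * exp (κ * w) ^ 3 := mul_le_mul_of_nonneg_right h2 hy3.le
    _ = u ^ 3 * (exp (κ * w) ^ 3 * exp (κ * w) ^ 3) := by ring

/-- On the window: if `e^{κ w} ≤ 1/u²` (`u > 0`) then `e^{(κ/2) w} ≤ 1/u`. [folklore] -/
theorem exp_half_mul_le_of_window {κ w u : ℝ} (hu : 0 < u) (h : exp (κ * w) ≤ 1 / u ^ 2) :
    exp (κ / 2 * w) ≤ 1 / u := by
  have h2 : exp (κ / 2 * w) ^ 2 = exp (κ * w) := by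
    rw [← exp_nat_mul]; ring_nf
  have hsq : exp (κ / 2 * w) ^ 2 ≤ (1 / u) ^ 2 := by rw [h2, one_div_pow]; exact h
  exact (pow_le_pow_iff_left₀ (exp_pos _).le (by positivity) two_ne_zero).1 hsq

/-! ## 2. Two weighted Cauchy–Schwarz inequalities; `withDensity e^{φ}` of a probability measure -/

/-- `2|ab| ≤ t a² + b²/t` for `t > 0`. [folklore] -/
theorem two_mul_abs_mul_le {a b t : ℝ} (ht : 0 < t) : 2 * |a * b| ≤ t * a ^ 2 + b ^ 2 / t := by
  rw [abs_mul]
  have h1 : 0 ≤ (t * |a| - |b|) ^ 2 := sq_nonneg _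
  have ha2 : |a| ^ 2 = a ^ 2 := sq_abs a
  have hb2 : |b| ^ 2 = b ^ 2 := sq_abs b
  have key : 2 * (|a| * |b|) * t ≤ (t * a ^ 2 + b ^ 2 / t) * t := by
    have e : (t * a ^ 2 + b ^ 2 / t) * t = t ^ 2 * a ^ 2 + b ^ 2 := by
      rw [add_mul, div_mul_cancel₀ _ ht.ne']
      ring
    rw [e]
    nlinarith [h1, ha2, hb2, abs_nonneg a, abs_nonneg b]
  exact le_of_mul_le_mul_right key ht

/-- `(A + B)² ≤ (1 + t) A² + (1 + 1/t) B²` for `t > 0`. [folklore] -/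
theorem add_sq_le_weighted {A B t : ℝ} (ht : 0 < t) :
    (A + B) ^ 2 ≤ (1 + t) * A ^ 2 + (1 + 1 / t) * B ^ 2 := by
  have h := two_mul_abs_mul_le (a := A) (b := B) ht
  have h2 : 2 * (A * B) ≤ 2 * |A * B| := by linarith [le_abs_self (A * B)]
  have e1 : (1 + 1 / t) * B ^ 2 = B ^ 2 + B ^ 2 / t := by ring
  have e2 : (A + B) ^ 2 = A ^ 2 + 2 * (A * B) + B ^ 2 := by ring
  have e3 : (1 + t) * A ^ 2 = A ^ 2 + t * A ^ 2 := by ring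
  linarith [h, h2, e1, e2, e3]

/-- A probability measure written as `μ₀ · e^{φ}` (`withDensity`): `e^{φ} ∈ L¹(μ₀)` with integral `1`,
and the measure is `μ₀.tilted φ`. [folklore] -/
theorem tilted_of_withDensity_exp {μ₀ ν : Measure (PhaseSpace N)} [IsProbabilityMeasure ν]
    {φ : PhaseSpace N → ℝ} (hφm : Measurable φ)
    (hν : ν = μ₀.withDensity (fun x => ENNReal.ofReal (exp (φ x)))) :
    Integrable (fun x => exp (φ x)) μ₀ ∧ ∫ x, exp (φ x) ∂μ₀ = 1 ∧ ν = μ₀.tilted φ := by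
  have hlin : ∫⁻ x, ENNReal.ofReal (exp (φ x)) ∂μ₀ = 1 := by
    rw [← setLIntegral_univ, ← withDensity_apply _ MeasurableSet.univ, ← hν, measure_univ]
  have h0 : 0 ≤ᵐ[μ₀] fun x => exp (φ x) := ae_of_all _ fun x => (exp_pos _).le
  have hint : Integrable (fun x => exp (φ x)) μ₀ := by
    refine ⟨hφm.exp.aestronglyMeasurable, ?_⟩
    rw [hasFiniteIntegral_iff_ofReal h0, hlin]
    exact ENNReal.one_lt_top
  have h1 : ∫ x, exp (φ x) ∂μ₀ = 1 := by
    rw [integral_eq_lintegral_of_nonneg_ae h0 hφm.exp.aestronglyMeasurable, hlin, ENNReal.toReal_one]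
  refine ⟨hint, h1, ?_⟩
  show ν = μ₀.withDensity (fun x => ENNReal.ofReal (exp (φ x) / ∫ x, exp (φ x) ∂μ₀))
  simp only [h1, div_one]
  exact hν

end Summit.AtomisticToContinuum.FouriersLaw.Theorems.ExtensiveSnapshotIrreversibility.EnergyWindow

end
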